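import Summits.BirchSwinnertonDyer.Rank1Residual.Additive.X3BranchKummerLayerTwistedZeta
import Summits.BirchSwinnertonDyer.Rank1Residual.Additive.X3BranchKummerLayerLocal
import HarnessLib

/-!
# X3, the DEGENERATE rows OFF the sub-locus: INERTIA AWAY FROM `3` AND THE NORM FIXES EVERY CONJUGATE
# RADICAL OF AN ELEMENT OF `ℤ[ζ₉]` (cell `bsd-eis`, seat `bsd-eis-x3` gen 7; sixth brick of the T-side
# over the first layer `ℚ_1` (MEMO-9 §2.4 (f)): the input `hIβ` of
# `KummerLayerTwisted.twistedChar_conj_eq_zero_of_forall` and `hIζ`; route K1 `AdditiveBranchIMC`,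
# crux `GordTwoRankZeroOffCaseOne` — supports only)

HONEST FRAMING (`run/shared/lean/pub/bsd-eis/README.md` §4): THEOREMS ONLY (no `def`, no named fact,
no `sorry`); nothing is booked; no label, tier or count of record moves.

## What

`b = B(ζ₉) ∈ ℤ[ζ₉]` with a complementary `b' = B'(ζ₉)` and `b·b' = n ∈ ℕ` (for the T-side radicals
`b_j = ϖ_j c(ϖ_j)²`, `n = ℓ³`); `β³ = b`; `v` a finite place with `v ∤ 3n`. Then EVERY element of the
inertia group `I_v` (of the tree's chosen place) fixes `ζ₉` (`inertia_smul_zeta9`: the mod-`9`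
cyclotomic character is unramified at `v ∤ 3`) and fixes EVERY CONJUGATE RADICAL `σβ`, `σ ∈ Γ_ℚ`
(`inertia_smul_conj_radical`): `σβ` is a cube root of `σb = B(σζ₉) = B(ζ₉^k) ∈ ℤ[ζ₉]`, an algebraic
integer with `σb·σb' = n`, fixed by `I_v`, so gen 7's inertia lemma
`KummerLayerClasses.smul_eq_self_of_mem_inertia_of_pow_eq_of_dvd` (file `X3BranchKummerLayerLocal`) applies.
References: [Washington1997] Prop. 2.3; [SerreLocalFields1979] Ch. X §3; [NeukirchANT1999] I (10.4).
-/

set_option autoImplicit false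

noncomputable section

open scoped Classical

namespace Summit.BirchSwinnertonDyer.Rank1Residual.Additive

namespace KummerLayerTwisted

open Field Polynomial NumberField IsDedekindDomain
  Literature.NumberTheory.GaloisRepresentations Literature.NumberTheory.EllipticCurves
  Literature.NumberTheory.EllipticCurves.GreenbergSelmer

/-- **Integrality of `B(x)`** for `B ∈ ℤ[X]` and `x` integral over `𝓞 ℚ`. [folklore] -/
theorem isIntegral_aeval_int {x : AlgebraicClosure ℚ} (hx : IsIntegral (𝓞 ℚ) x) (B : ℤ[X]) :
    IsIntegral (𝓞 ℚ) (aeval x B) := by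
  induction B using Polynomial.induction_on' with
  | add p q hp hq => rw [map_add]; exact hp.add hq
  | monomial k a =>
    rw [aeval_monomial, eq_intCast]
    have ha : IsIntegral (𝓞 ℚ) ((a : ℤ) : AlgebraicClosure ℚ) := by
      have := isIntegral_algebraMap (R := 𝓞 ℚ) (A := AlgebraicClosure ℚ) (x := (a : 𝓞 ℚ))
      rwa [map_intCast] at this
    exact ha.mul (hx.pow k)

/-- **`I_v` fixes `ζ₉` for `v ∤ 3`** (the mod-`9` cyclotomic character is unramified away from `3`).
[cite: Washington1997, Prop. 2.3] -/
theorem inertia_smul_zeta9 {ζ : AlgebraicClosure ℚ} (hζ : IsPrimitiveRoot ζ 9)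
    {v : HeightOneSpectrum (𝓞 ℚ)} (h3v : ((3 : ℕ) : 𝓞 ℚ) ∉ v.asIdeal)
    {τ : absoluteGaloisGroup ℚ} (hτ : τ ∈ inertia v) : τ • ζ = ζ := by
  haveI : NeZero ((9 : ℕ) : ℚ) := ⟨by norm_num⟩
  haveI : Fact (1 < 9) := ⟨by norm_num⟩
  set 𝔓 := adicCompletionPrime ℚ v with h𝔓def
  have h𝔓 : 𝔓 ∈ v.primesAbove := adicCompletionPrime_mem_primesAbove ℚ v
  have hτ' : τ ∈ 𝔓.inertia (absoluteGaloisGroup ℚ) := by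
    rw [h𝔓def, inertia_adicCompletionPrime_eq_map_absInertia]; exact hτ
  -- the residue characteristic `q ≠ 3` of `v`
  set q : ℕ := (Rat.HeightOneSpectrum.primesEquiv (R := 𝓞 ℚ) v : ℕ) with hqdef
  have hq : q.Prime := (Rat.HeightOneSpectrum.primesEquiv (R := 𝓞 ℚ) v).2
  have hqv : (q : 𝓞 ℚ) ∈ v.asIdeal := Rat.HeightOneSpectrum.natCast_natGenerator_mem v
  have hq9 : ¬ q ∣ 9 := by
    intro h
    have hd : q ∣ 3 := hq.dvd_of_dvd_pow (show q ∣ 3 ^ 2 by norm_num; exact h)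
    have h3 : q = 3 := (Nat.prime_dvd_prime_iff_eq hq Nat.prime_three).mp hd
    exact h3v (by rw [← h3]; exact_mod_cast hqv)
  have hχ := Rat.modNCyclotomicCharacter_eq_one_of_mem_inertia (N := 9) hq hq9 hqv h𝔓 hτ'
  have h := modNCyclotomicCharacter_spec ℚ 9 τ ζ hζ.pow_eq_one
  rw [hχ, Units.val_one, ZMod.val_one, pow_one] at h
  exact h

/-- **`I_v` fixes every conjugate radical of `b = B(ζ₉)` when `v ∤ 3n`, `b·b' = n`, `b' = B'(ζ₉)`.**
For `σ ∈ Γ_ℚ` and `β³ = b`: `τ(σβ) = σβ` for every `τ ∈ I_v`. [cite: SerreLocalFields1979, Ch. X §3]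
[cite: NeukirchANT1999, I (10.4)] -/
theorem inertia_smul_conj_radical {ζ : AlgebraicClosure ℚ} (hζ : IsPrimitiveRoot ζ 9) (B B' : ℤ[X])
    {n : ℕ} (hn : aeval ζ B * aeval ζ B' = (n : AlgebraicClosure ℚ))
    {β : AlgebraicClosure ℚ} (hβ : β ^ 3 = aeval ζ B)
    {v : HeightOneSpectrum (𝓞 ℚ)} (h3v : ((3 : ℕ) : 𝓞 ℚ) ∉ v.asIdeal)
    (hnv : ((n : ℕ) : 𝓞 ℚ) ∉ v.asIdeal) {τ : absoluteGaloisGroup ℚ} (hτ : τ ∈ inertia v)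
    (σ : absoluteGaloisGroup ℚ) : τ • (σ • β) = σ • β := by
  haveI : Fact (Nat.Prime 3) := ⟨Nat.prime_three⟩
  -- `σζ = ζ^k`
  have h9 : (σ • ζ) ^ 9 = 1 := by rw [← smul_pow', hζ.pow_eq_one, smul_one]
  obtain ⟨k, -, hk⟩ := hζ.eq_pow_of_pow_eq_one h9
  -- the conjugate data
  have hσb : σ • aeval ζ B = aeval (ζ ^ k) B := by rw [smul_aeval_eq, ← hk]
  have hσb' : σ • aeval ζ B' = aeval (ζ ^ k) B' := by rw [smul_aeval_eq, ← hk]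
  have hζint : IsIntegral (𝓞 ℚ) ζ := (hζ.isIntegral (by norm_num)).tower_top
  have hζkint : IsIntegral (𝓞 ℚ) (ζ ^ k) := hζint.pow k
  have hprod : aeval (ζ ^ k) B * aeval (ζ ^ k) B' = (n : AlgebraicClosure ℚ) := by
    rw [← hσb, ← hσb', ← smul_mul', hn, absoluteGaloisGroup.smul_def, map_natCast]
  have hβσ : (σ • β) ^ 3 = aeval (ζ ^ k) B := by rw [← smul_pow', hβ, hσb]
  have hτζ : τ • ζ = ζ := inertia_smul_zeta9 hζ h3v hτ
  have hτb : τ • aeval (ζ ^ k) B = aeval (ζ ^ k) B := by rw [smul_aeval_eq, smul_pow', hτζ]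
  exact KummerLayerClasses.smul_eq_self_of_mem_inertia_of_pow_eq_of_dvd (p := 3)
    (isPrimitiveRoot_zeta9_cube hζ) (isIntegral_aeval_int hζkint B) (isIntegral_aeval_int hζkint B')
    hprod hβσ h3v hnv hτ hτb

end KummerLayerTwisted

end Summit.BirchSwinnertonDyer.Rank1Residual.Additive

end
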